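import Summits.Ventures.QEC.Thresholds.ToricCodeDepolarizingKernelPT
import Summits.Ventures.QEC.Thresholds.ToricCodePhenomenologicalKernelZ3K8
import Literature.InformationTheory.QuantumCodes.ToricCodeMatching
import HarnessLib

/-!
# Certified toric-code thresholds for MINIMUM-WEIGHT PERFECT MATCHING decoders
# (perfect measurement, both sectors, depolarizing noise, and `T` noisy rounds)

Venture QEC, `Summits/Ventures/QEC/Thresholds/` (LADDER-QEC rung Q5, whose opening target reads «toric/surface +
MWPM under i.i.d. code-capacity noise — the DKLP 2002 self-avoiding-walk counting bound, made explicit and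
kernel-checked»; qec-type-09 gen 4, item 09.MWPM). Every toric threshold theorem of the tree is stated for
decoder families satisfying `Decoder.IsMinWeight … hammingNorm`. The Literature files
`GraphlikeSyndromes` / `MatchingCost` / `MatchingDecoders` PROVE the Edmonds–Johnson theorem (Korte–Vygen
Thm 12.9) «a minimum-cost perfect matching of the defects realised by geodesics is a minimum-weight chain» for
every graphlike syndrome map, and `ToricCodeMatching` PROVES that the toric code's star, plaquette and
space-time boundary maps are graphlike — LITERALLY the maps the minimum-weight theorems use: the bridging lemmas
are `ToricCode.syn_eq_graphSyn : syn L = graphSyn (starEnds L)` with `cycles_eq_graphCycles`,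
`ToricCode.xSyndrome_eq_graphSyn : (toricCode L).xSyndrome = graphSyn (plaqEnds L)` with `kerZ_eq_graphCycles`, and
`ToricCode.stSyn_eq_graphSyn : stSyn L T = graphSyn (stLinkEnds L T)` with `stCycles_eq_graphCycles` (the `stSyn` /
`stCycles` of `ToricCodePhenomenological.lean`, i.e. exactly the decoding problem of `phenom_accuracyThreshold_gt_0110`).
This file draws the Summits-level consequences: every theorem below
holds for EVERY minimum-weight-perfect-matching decoder family — any admissible link metric `m L` (symmetric,
triangle inequality, `≤ 1` across links; e.g. the lattice distance `starMetric` / `plaqMetric` / `stMetric`),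
any tie-breaking among minimum-cost matchings, any choice of geodesics (`IsMatchingDecoder (m L) (D L)`) — which is
the decoder Dennis–Kitaev–Landahl–Preskill analyse ("the perfect matching algorithm of Edmonds", §4.4 p. 18;
§5.1 p. 19) and the one implementations run.

| theorem | statement (all UNCONDITIONAL, tier CERTIFIED (kernel), axioms standard) |
|---|---|
| `toric_mwpm_threshold_kernelK10`, `toric_mwpm_accuracyThreshold_gt_0348`, `toric_mwpm_hasThreshold_0348`, `toric_mwpm_decaysExponentially_0348` | `Z`-sector, perfect measurement, every MWPM family: threshold `≥ p₀(2.7248)`, **`p_c^{MWPM} > .0348`**, exponential decay below |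
| `toric_mwpm_failureProb_le` | DKLP finite-size bound `P_fail ≤ 2L²C r^L/(ν(1-r))` for one MWPM decoder |
| `toric_x_mwpm_accuracyThreshold_gt_0348` | `X`-sector (plaquette matching): `p_c > .0348` |
| `toric_depolarizing_mwpm_threshold_kernelK10`, `toric_depolarizing_mwpm_accuracyThreshold_gt_0522` | depolarizing noise, sector-wise MWPM: `p_c > .0522` |
| `phenom_mwpm_threshold_kernelZ3K8`, `phenom_mwpm_accuracyThreshold_gt_0110`, `phenom_mwpm_decaysExponentially_0110` | `T(L)` noisy rounds (`q = p`, poly-bounded `T`), SPACE-TIME MWPM: **`p_c > .0110`** |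
| `exists_mwpm_family_accuracyThreshold_gt_0348`, `exists_st_mwpm_family_accuracyThreshold_gt_0110` | non-vacuity: MWPM families with these certified thresholds exist (lattice metric) |
Certified = LOWER bounds on the threshold (qec-ref-3 W-1 wording). The printed values `.0373` (perfect) and
`.0114` (phenomenological) remain CLAIMS; the CHECKED-native / PT-conditional tiers of the min-weight files apply
to MWPM families verbatim by the same one-line substitution and are not restated here.

## References
* [DennisEtAl2002] E. Dennis, A. Kitaev, A. Landahl, J. Preskill, *Topological quantum memory*, J. Math.
  Phys. 43 (2002) 4452–4505, arXiv:quant-ph/0110143, §4.4 p. 18, §5.1 p. 19, §5.3 eqs. (p_c_2d),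
  (threshold_iso_num), (fail_2d), (fail_iso).
* [KorteVygen2002] B. Korte, J. Vygen, *Combinatorial Optimization*, 2nd ed., Springer (2002), §12.2
  Thm 12.9 (Edmonds–Johnson).
-/

namespace Summit.Ventures.QEC.Thresholds

open Filter Topology Finset
open Literature.InformationTheory.QuantumCodes
open Literature.InformationTheory.QuantumCodes.ToricCode
open Literature.Probability.RandomPlanarGeometry

/-! ### Perfect measurement, `Z`-sector (site defects matched on the lattice) -/

/-- **Toric threshold `≥ p₀(2.7248)` for every MWPM decoder family** (any admissible link metric, any
tie-break, any geodesics) — UNCONDITIONAL, tier CERTIFIED (kernel): the minimum-weight theorem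
`toricThreshold_kernelK10` through `isMinWeight_of_isMatchingDecoder_star` (proved).
[cite: DennisEtAl2002, §4.4 p. 18 and §5.3 eq. (threshold_2d)] -/
theorem toric_mwpm_threshold_kernelK10 (m : (L : ℕ) → EdgeMetric (starEnds (L + 1)))
    {D : (L : ℕ) → ZDecoder (L + 1)} (hD : ∀ L, IsMatchingDecoder (m L) (D L)) :
    IsThresholdLowerBound (toricFailureFamily D) (thresholdValue 2.7248) :=
  toricThreshold_kernelK10 fun L => isMinWeight_of_isMatchingDecoder_star (hD L)

/-- **`p_c^{MWPM} > .0348`** for the toric code under independent phase flips with perfect measurement, for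
EVERY minimum-weight-perfect-matching decoder family — UNCONDITIONAL, tier CERTIFIED (kernel); a certified
LOWER bound on the threshold (printed `.0373` remains a CLAIM). [cite: DennisEtAl2002, §4.4 p. 18 and §5.3 eq. (p_c_2d)] -/
theorem toric_mwpm_accuracyThreshold_gt_0348 (m : (L : ℕ) → EdgeMetric (starEnds (L + 1)))
    {D : (L : ℕ) → ZDecoder (L + 1)} (hD : ∀ L, IsMatchingDecoder (m L) (D L)) :
    (0.0348 : ℝ) < accuracyThreshold (toricFailureFamily D) :=
  accuracyThreshold_gt_0348 fun L => isMinWeight_of_isMatchingDecoder_star (hD L)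

/-- `HasThreshold` (row-09 PMF vocabulary) at `.0348` for every MWPM family — UNCONDITIONAL, kernel.
[cite: DennisEtAl2002, §4.4 p. 18 and §5.3 eq. (p_c_2d)] -/
theorem toric_mwpm_hasThreshold_0348 (m : (L : ℕ) → EdgeMetric (starEnds (L + 1)))
    {D : (L : ℕ) → ZDecoder (L + 1)} (hD : ∀ L, IsMatchingDecoder (m L) (D L)) :
    HasThreshold (fun L p => (D L).logicalFailureProb (syn (L + 1)) (boundaries (L + 1))
      (iidLaw (bitLaw (min p.toNNReal 1) (min_le_right _ _)))) 0.0348 :=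
  hasThreshold_toric_0348 fun L => isMinWeight_of_isMatchingDecoder_star (hD L)

/-- **Exponential decay of the MWPM failure probability at every `0 ≤ p ≤ .0348`** — UNCONDITIONAL, kernel.
[cite: DennisEtAl2002, §5.3 eq. (fail_2d)] -/
theorem toric_mwpm_decaysExponentially_0348 (m : (L : ℕ) → EdgeMetric (starEnds (L + 1)))
    {D : (L : ℕ) → ZDecoder (L + 1)} (hD : ∀ L, IsMatchingDecoder (m L) (D L)) {p : ℝ} (hp₀ : 0 ≤ p)
    (hpp : p ≤ 0.0348) : DecaysExponentially (toricFailureFamily D) p :=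
  toric_decaysExponentially_0348 (fun L => isMinWeight_of_isMatchingDecoder_star (hD L)) hp₀ hpp

/-- **DKLP's finite-size bound for one MWPM decoder**: under `cₙ ≤ C νⁿ` (`ν > 0`), for `L ≥ 3`, `0 ≤ p ≤ 1/2`
and `r := 2ν√(p(1-p)) < 1`, `Prob_fail ≤ 2L²C r^L/(ν(1-r))` — tier CERTIFIED (kernel), parametric in the
walk count. [cite: DennisEtAl2002, §5.3 eq. (fail_2d)] -/
theorem toric_mwpm_failureProb_le {C ν : ℝ} (hν : 0 < ν) (hc : SAWCountBound C ν) (L : ℕ) [NeZero L]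
    (hL : 3 ≤ L) {m : EdgeMetric (starEnds L)} {D : ZDecoder L} (hD : IsMatchingDecoder m D) {p : ℝ}
    (hp₀ : 0 ≤ p) (hp : p ≤ 1 / 2) (hr : 2 * ν * Real.sqrt (p * (1 - p)) < 1) :
    failureProb L D p ≤ 2 * (L : ℝ) ^ 2 * C * (2 * ν * Real.sqrt (p * (1 - p))) ^ L /
      (ν * (1 - 2 * ν * Real.sqrt (p * (1 - p)))) :=
  toric_failureProb_le hν hc L hL (isMinWeight_of_isMatchingDecoder_star hD) hp₀ hp hr

/-- **Non-vacuity**: there IS an MWPM family (lattice distance `starMetric`, some tie-break, some geodesics),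
and its certified threshold exceeds `.0348`. [cite: DennisEtAl2002, §4.4 p. 18] -/
theorem exists_mwpm_family_accuracyThreshold_gt_0348 :
    ∃ D : (L : ℕ) → ZDecoder (L + 1), (∀ L, IsMatchingDecoder (starMetric (L + 1)) (D L)) ∧
      (0.0348 : ℝ) < accuracyThreshold (toricFailureFamily D) := by
  choose D hD using fun L => exists_isMatchingDecoder_star (L + 1)
  exact ⟨D, hD, toric_mwpm_accuracyThreshold_gt_0348 (fun L => starMetric (L + 1)) hD⟩

/-! ### Perfect measurement, `X`-sector (plaquette defects matched on the dual lattice) and depolarizing noise -/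

/-- **`p_c^X > .0348` for every MWPM decoder family of the plaquette syndrome** (bit flips) — UNCONDITIONAL,
kernel. [cite: DennisEtAl2002, §4.4 p. 18 and §5.3 eq. (p_c_2d)] -/
theorem toric_x_mwpm_accuracyThreshold_gt_0348 (m : (L : ℕ) → EdgeMetric (plaqEnds (L + 1)))
    (DX : (L : ℕ) → Decoder (Syndrome (L + 1)) (Chain (L + 1))) (hDX : ∀ L, IsMatchingDecoder (m L) (DX L)) :
    (0.0348 : ℝ) < accuracyThreshold (xFailureFamily (fun L => toricCode (L + 1)) DX) :=
  toric_x_accuracyThreshold_gt_0348 DX fun L => isMinWeight_of_isMatchingDecoder_plaq (hDX L)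

/-- **Depolarizing toric threshold `≥ (3/2)·p₀(2.7248)` for sector-wise MWPM decoding** (plaquette matching for
the bit flips, site matching for the phase flips; any metrics, tie-breaks, geodesics) — UNCONDITIONAL, kernel.
[cite: DennisEtAl2002, §4.1 (depolarizing channel vs. independent X/Z errors) and §4.4 p. 18] -/
theorem toric_depolarizing_mwpm_threshold_kernelK10 (mX : (L : ℕ) → EdgeMetric (plaqEnds (L + 1)))
    (mZ : (L : ℕ) → EdgeMetric (starEnds (L + 1)))
    (DX : (L : ℕ) → Decoder (Syndrome (L + 1)) (Chain (L + 1))) (DZ : (L : ℕ) → ZDecoder (L + 1))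
    (hDX : ∀ L, IsMatchingDecoder (mX L) (DX L)) (hDZ : ∀ L, IsMatchingDecoder (mZ L) (DZ L)) :
    IsThresholdLowerBound (depolarizingFailureFamily (fun L => toricCode (L + 1)) DX DZ)
      (3 / 2 * thresholdValue 2.7248) :=
  toric_depolarizing_isThresholdLowerBound_kernelK10 DX DZ
    (fun L => isMinWeight_of_isMatchingDecoder_plaq (hDX L)) fun L => isMinWeight_of_isMatchingDecoder_star (hDZ L)

/-- **`p_c^depol > .0522` for sector-wise MWPM decoding of the toric code** — UNCONDITIONAL, kernel.
[cite: DennisEtAl2002, §4.1 and §5.3] -/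
theorem toric_depolarizing_mwpm_accuracyThreshold_gt_0522 (mX : (L : ℕ) → EdgeMetric (plaqEnds (L + 1)))
    (mZ : (L : ℕ) → EdgeMetric (starEnds (L + 1)))
    (DX : (L : ℕ) → Decoder (Syndrome (L + 1)) (Chain (L + 1))) (DZ : (L : ℕ) → ZDecoder (L + 1))
    (hDX : ∀ L, IsMatchingDecoder (mX L) (DX L)) (hDZ : ∀ L, IsMatchingDecoder (mZ L) (DZ L)) :
    (0.0522 : ℝ) < accuracyThreshold (depolarizingFailureFamily (fun L => toricCode (L + 1)) DX DZ) :=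
  toric_depolarizing_accuracyThreshold_gt_0522 DX DZ
    (fun L => isMinWeight_of_isMatchingDecoder_plaq (hDX L)) fun L => isMinWeight_of_isMatchingDecoder_star (hDZ L)

/-! ### Noisy measurement: `T` rounds, space-time matching (DKLP §5) -/

/-- **Phenomenological threshold `≥ p₀(4.778)` for every SPACE-TIME MWPM decoder family** (syndrome changes
matched by a minimum-cost perfect matching in the three-dimensional lattice, any admissible metric, tie-break,
geodesics; `q = p`, every polynomially bounded schedule `T`) — UNCONDITIONAL, tier CERTIFIED (kernel). The matching
problem is literally the `stSyn (L+1) (T L)` / `stCycles` decoding problem of `phenomThreshold_kernelZ3K8` (bridge: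
`ToricCode.stSyn_eq_graphSyn`, `ToricCode.stCycles_eq_graphCycles`, used inside `isMinWeight_of_isMatchingDecoder_st`).
[cite: DennisEtAl2002, §5.1 p. 19 and §5.3 eq. (threshold_iso_num)] -/
theorem phenom_mwpm_threshold_kernelZ3K8 {T : ℕ → ℕ} (hT : IsPolyBounded T)
    (m : (L : ℕ) → EdgeMetric (stLinkEnds (L + 1) (T L))) {D : (L : ℕ) → STDecoder (L + 1) (T L)}
    (hD : ∀ L, IsMatchingDecoder (m L) (D L)) :
    IsThresholdLowerBound (phenomFailureFamily T D) (thresholdValue 4.778) :=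
  phenomThreshold_kernelZ3K8 hT fun L => isMinWeight_of_isMatchingDecoder_st (hD L)

/-- **`p_c^{MWPM} > .0110` under phenomenological noise** (`q = p`) for every space-time MWPM decoder family and
every polynomially bounded schedule — UNCONDITIONAL, kernel; a certified LOWER bound (printed `.0114` remains a
CLAIM). [cite: DennisEtAl2002, §5.1 p. 19 and §5.3 eq. (threshold_iso_num)] -/
theorem phenom_mwpm_accuracyThreshold_gt_0110 {T : ℕ → ℕ} (hT : IsPolyBounded T)
    (m : (L : ℕ) → EdgeMetric (stLinkEnds (L + 1) (T L))) {D : (L : ℕ) → STDecoder (L + 1) (T L)}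
    (hD : ∀ L, IsMatchingDecoder (m L) (D L)) :
    (0.0110 : ℝ) < accuracyThreshold (phenomFailureFamily T D) :=
  phenom_accuracyThreshold_gt_0110 hT fun L => isMinWeight_of_isMatchingDecoder_st (hD L)

/-- **Exponential decay at every `0 ≤ p ≤ .0110`** for space-time MWPM families — UNCONDITIONAL, kernel.
[cite: DennisEtAl2002, §5.3 eq. (fail_iso)] -/
theorem phenom_mwpm_decaysExponentially_0110 {T : ℕ → ℕ} (hT : IsPolyBounded T)
    (m : (L : ℕ) → EdgeMetric (stLinkEnds (L + 1) (T L))) {D : (L : ℕ) → STDecoder (L + 1) (T L)}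
    (hD : ∀ L, IsMatchingDecoder (m L) (D L)) {p : ℝ} (hp₀ : 0 ≤ p) (hpp : p ≤ 0.0110) :
    DecaysExponentially (phenomFailureFamily T D) p :=
  phenom_decaysExponentially_0110 hT (fun L => isMinWeight_of_isMatchingDecoder_st (hD L)) hp₀ hpp

/-- **Non-vacuity** (schedule `T(L) = L + 1`, lattice metric of the space-time complex): a space-time MWPM family
exists and its certified phenomenological threshold exceeds `.0110`. [cite: DennisEtAl2002, §5.1 p. 19] -/
theorem exists_st_mwpm_family_accuracyThreshold_gt_0110 :
    ∃ D : (L : ℕ) → STDecoder (L + 1) (L + 1), (∀ L, IsMatchingDecoder (stMetric (L + 1) (L + 1)) (D L)) ∧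
      (0.0110 : ℝ) < accuracyThreshold (phenomFailureFamily (fun L => L + 1) D) := by
  choose D hD using fun L => exists_isMatchingDecoder_st (L + 1) (L + 1)
  exact ⟨D, hD, phenom_mwpm_accuracyThreshold_gt_0110 isPolyBounded_succ (fun L => stMetric (L + 1) (L + 1)) hD⟩

end Summit.Ventures.QEC.Thresholds
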